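import Summits.QuantumFields.YangMills.Theorems.UnitScaleTiltFluctuationComparisonRegPrGlobalSlackTwoProfile
import HarnessLib

/-!
# `UnitScaleTiltFluctuationComparisonRegPrGlobalSlackHigherProfile` — THE FULLY SHIFTED DOOR: THE REGISTERED ONE-PROFILE SLACK ROW AT ANY HIGHER LOG-PROFILE `p₁ ≥ p₀` GIVES THE
# CAUCHY SOCKET AT THE RECORD'S PROFILE, AND THE DECIDING CRUX THROUGH IT (crux `FluctuationComparisonRegPrIntL`, stmt-QuantumFields-20520, skeleton v5kC; width-lever lane B
# «(R1) print's χ of [Balaban1985UV3] (47) back», seat ym-ust-19935-r1 g5; companion of `…GlobalSlackTwoProfile`, p589354)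

A supplier that works entirely at the log-profile its displays carry (`p₁ = p₀ + r₀` from the (28) collar polylog, say) proves the REGISTERED-currency row
`GlobalSlackOn.GlobalSupRateTSlackOn D S b₀ p₁ a σ C` — window AND both summands at `p₁` — i.e. the text of 3⁗χ/(i*)χ with `𝔠.p₀ ↦ p₁` inside the slack row.  Since the `p₀`-window
is inside the `p₁`-window (`GlobalSlackOn.θBal_mono_p`) and the S-E″ counting at `p₁` is the landed `GlobalSlackOn.summable_slackRadii` verbatim, that row already gives
`PrintChi.PintCauchyOn F γ b₀ p₀ S m D.PintH` at the record's profile — no order trade, no new definition, no binder edit: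

* `cauchyOn_of_globalSupRateTSlackOn_higherProfile` (+ full-window twin `cauchyAtHeights_of_globalSupRateTSlack_higherProfile`, slot `levelCauchyOnOfGlobalSupRateTSlackOn_higherProfile_dec`);
* **`regPrIntL_of_recChi_slackOnChi_higherProfile_allL`** : STUB 1's text → T8's text → 2′χ → (∀ odd `L > 1`, ∀ `μ ∈ (0,1)`, every record/[7]-constants: `∃ a ∈ (0,1), ∃ p₁ ≥ 𝔠.p₀`,
  coherent χ-packages and a polymerisation with `∀ ε₀ ∈ (0,a₀], GlobalSupRateTSlackOn (dataOfV3chi p π) (ChiGood … ε₀ μ) 𝔠.b₀ p₁ a σ C`) → `FluctuationComparisonRegPrIntL`.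
HONEST FRAMING: counting and bookkeeping over hypothesis schemas; nothing of [Balaban1985UV3]/[King1986] asserted; no numerics; registry untouched (`--supports stmt-QuantumFields-20520`);
the door supplies no row.  YM₃ on T³ is a rung, not the Clay problem / a gap.

References: C. King, CMP 102 (1986) 649–677 [King1986] (Thm 3.4 (3.9) p.656, (3.12)–(3.13) p.657, (3.42) p.660); T. Bałaban, CMP 102 (1985) 255–275 [Balaban1985UV3] ((7) p.257,
(28) p.263, (41) p.266, (47) p.267, (57) p.270, Thm 2 p.272).
-/

set_option autoImplicit false

noncomputable section

open MeasureTheory Filter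
open Literature.MathematicalPhysics.QuantumFieldTheory.Balaban1983to89
open Literature.MathematicalPhysics.QuantumFieldTheory.Balaban1983to89.T3ContinuumYM3Torus
open Literature.MathematicalPhysics.QuantumFieldTheory.Balaban1983to89.T3LevelShift
open Literature.MathematicalPhysics.QuantumFieldTheory.Balaban1983to89.T3UnitScaleTilt
open Literature.MathematicalPhysics.QuantumFieldTheory.Balaban1983to89.T3AlphaInputsAC
open Literature.MathematicalPhysics.QuantumFieldTheory.Balaban1983to89.T3AlphaPolymerSocket
open Literature.MathematicalPhysics.QuantumFieldTheory.Balaban1983to89.T3AlphaInputsACTwoRunLevel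
open Summit.QuantumFields.YangMills.Theorems.GlobalSlack
open Summit.QuantumFields.YangMills.Theorems.PrintChi (PintCauchyOn ChiGood)

namespace Summit.QuantumFields.YangMills.Theorems.GlobalSlackOn

variable {F : T3Family} {γ : ℝ}

/-- **THE REGISTERED-CURRENCY ROW AT A HIGHER PROFILE GIVES THE SOCKET AT THE RECORD'S PROFILE** (pure counting, no block-size threshold): for `1 < L`, `0 < γ ≤ 1`, `0 < b₀`,
`0 < p₀ ≤ p₁`, `0 < a`, `0 ≤ C`, `m > (3+a)/a`, `7 ≤ σ`: `GlobalSupRateTSlackOn D S b₀ p₁ a σ C ⟹ PrintChi.PintCauchyOn F γ b₀ p₀ S m D.PintH` — the `p₀`-window data are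
`p₁`-window data (`θBal_mono_p`), and the radii are the one-profile radii at `p₁` (`summable_slackRadii` at `p₁`). [cite: King1986, Thm 3.4 (3.9) p.656, (3.12)-(3.13) p.657, (3.42) p.660] -/
theorem cauchyOn_of_globalSupRateTSlackOn_higherProfile (S : WinPred F) (D : AlphaDataT3 F γ) {b₀ p₀ p₁ a C : ℝ} {σ m : ℕ}
    (hL : 1 < F.L) (hγ : 0 < γ) (hγ1 : γ ≤ 1) (hb : 0 < b₀) (hp₀ : 0 < p₀) (hp : p₀ ≤ p₁) (ha : 0 < a) (hC : 0 ≤ C)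
    (hm : (3 + a) / a < (m : ℝ)) (hσ : 7 ≤ σ) (h : GlobalSupRateTSlackOn D S b₀ p₁ a σ C) :
    PintCauchyOn F γ b₀ p₀ S m D.PintH := by
  obtain ⟨c, hc⟩ := h
  have hp₁ : 0 < p₁ := lt_of_lt_of_le hp₀ hp
  have hcq : (0 : ℝ) < 1 / 8 := by norm_num
  have hσr : (7 : ℝ) ≤ σ := by exact_mod_cast hσ
  have hsum := summable_slackRadii (F := F) (γ := γ) (σ := σ) (m := m) hL hγ hγ1 hb hp₁ ha hC hm
    (ρ := ((F.L : ℝ)⁻¹) ^ ((1 - 1 / 8 : ℝ) / 2)) (Cθ := b₀ * ((p₁ / (1 / 8)) ^ p₁ * Real.exp (1 / 8 - p₁)) * γ ^ ((1 - 1 / 8 : ℝ) / 2))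
    (by positivity) (fun n => θBal_le_geometric_sharp hL.le hγ hγ1 hb.le hp₁ hcq n) (slack_ratio_lt_one hL (by nlinarith))
  refine pintCauchyOn_of_windowBoundOn D S _ (fun K => c K (K / m)) hsum (slackRadii_nonneg hL.le hγ hγ1 hb hC) (fun K V hV hS hS' => ?_)
  -- the `p₀`-window datum is a `p₁`-window datum
  have hV' : PlaqSmall (θBal F.L γ b₀ p₁ (K / m)) V := fun q => (hV q).trans_le (θBal_mono_p hL.le hγ hγ1 hb.le hp _)
  exact hc K (K / m) (Nat.div_le_self K m) V hV' hS hS'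

/-- **THE FULL-WINDOW TWIN**: `GlobalSupRateTSlack D b₀ p₁ a σ C ⟹ CauchyAtHeights D b₀ p₀ m` for `p₀ ≤ p₁` (the case `S = ⊤`) — 3⁗χ's text at a higher profile gives the
full socket at the record's profile. [cite: King1986, Thm 3.4 (3.9) p.656, (3.42) p.660] -/
theorem cauchyAtHeights_of_globalSupRateTSlack_higherProfile (D : AlphaDataT3 F γ) {b₀ p₀ p₁ a C : ℝ} {σ m : ℕ}
    (hL : 1 < F.L) (hγ : 0 < γ) (hγ1 : γ ≤ 1) (hb : 0 < b₀) (hp₀ : 0 < p₀) (hp : p₀ ≤ p₁) (ha : 0 < a) (hC : 0 ≤ C)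
    (hm : (3 + a) / a < (m : ℝ)) (hσ : 7 ≤ σ) (h : GlobalSupRateTSlack D b₀ p₁ a σ C) :
    CauchyAtHeights D b₀ p₀ m := by
  obtain ⟨r', c, hs, h0, hae⟩ := cauchyOn_of_globalSupRateTSlackOn_higherProfile (fun _ _ _ _ => True) D hL hγ hγ1 hb hp₀ hp ha hC hm hσ
    (on_of_global D _ h)
  refine ⟨r', c, hs, h0, fun K => ?_⟩
  filter_upwards [hae K] with V hV
  exact fun hs' hpos hpos' => hV hs' trivial trivial hpos hpos'

/-- **THE HIGHER-PROFILE S-E″ SLOT, REGISTERED QUANTIFIER SHAPE** (`ε₁ = γ₁ = 1`, `m₀ = ⌈(3+a)/a⌉ + 1`; `p₀ ≤ p₁`, `σ ≥ 7`, `C ≥ 0`):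
`GlobalSupRateTSlackOn D S b₀ p₁ a σ C → PrintChi.PintCauchyOn F γ b₀ p₀ S m D.PintH`. [cite: King1986, Thm 3.4 (3.9) p.656] -/
theorem levelCauchyOnOfGlobalSupRateTSlackOn_higherProfile_dec :
    ∀ (L : ℕ), Odd L → 1 < L → ∀ (a : ℝ), 0 < a →
      ∃ ε₁ : ℝ, 0 < ε₁ ∧ ∀ (ε₀ : ℝ), 0 < ε₀ → ε₀ ≤ ε₁ → ∃ m₀ : ℕ, ∀ (m : ℕ), m₀ ≤ m → ∀ (b₀ p₀ : ℝ), 0 < b₀ → 2 < p₀ →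
        ∃ γ₁ : ℝ, 0 < γ₁ ∧ ∀ (F : T3Family) (γ : ℝ), F.L = L → 0 < γ → γ ≤ γ₁ →
          ∀ (S : WinPred F) (D : AlphaDataT3 F γ) (p₁ : ℝ) (σ : ℕ) (C : ℝ), p₀ ≤ p₁ → 7 ≤ σ → 0 ≤ C →
            GlobalSupRateTSlackOn D S b₀ p₁ a σ C → PintCauchyOn F γ b₀ p₀ S m D.PintH := by
  intro L _ hL a ha
  refine ⟨1, one_pos, fun ε₀ _ _ => ⟨Nat.ceil ((3 + a) / a) + 1, fun m hm b₀ p₀ hb hp => ?_⟩⟩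
  refine ⟨1, one_pos, fun F γ hF hγ hγ1 S D p₁ σ C hp₁ hσ hC h => ?_⟩
  have hL' : 1 < F.L := by rw [hF]; exact hL
  exact cauchyOn_of_globalSupRateTSlackOn_higherProfile S D hL' hγ hγ1 hb (by linarith) hp₁ ha hC (GlobalSlack.lt_of_ceil_succ_le hm) hσ h

end Summit.QuantumFields.YangMills.Theorems.GlobalSlackOn

namespace Summit.QuantumFields.YangMills.Theorems.InteriorExcision

open Literature.MathematicalPhysics.QuantumFieldTheory.Balaban1983to89.T3UnitLawDensityEML (ℰp)
open Literature.MathematicalPhysics.QuantumFieldTheory.Balaban1983to89.T3TiltDescent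
open Literature.MathematicalPhysics.QuantumFieldTheory.Balaban1983to89.T3RegularMinimiser
open Literature.MathematicalPhysics.QuantumFieldTheory.Balaban1983to89.T3PrintedRegularMinimiser
open Literature.MathematicalPhysics.QuantumFieldTheory.Balaban1983to89.T3PrintedMinimiserExistence
open Literature.MathematicalPhysics.QuantumFieldTheory.Balaban1983to89.T3SmallLiftHistory
open Literature.MathematicalPhysics.QuantumFieldTheory.Balaban1983to89.T3LogComparisonSocket
open Literature.MathematicalPhysics.QuantumFieldTheory.Balaban1983to89.T3LowerAlongMinimisersSplit (MinimisersIn8At)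
open Literature.MathematicalPhysics.QuantumFieldTheory.Balaban1983to89.T3InteriorExcision
open Summit.QuantumFields.YangMills.Theorems.PrintChi
open Summit.QuantumFields.YangMills.Theorems.GlobalSlackOn (levelCauchyOnOfGlobalSupRateTSlackOn_higherProfile_dec)
open Summit.QuantumFields.YangMills.Theorems.LogComparisonRepAtHeightsOn (atHeights printChiSets)

/-- **THE DATUM-LEVEL TRIPLE AT ONE BLOCK SIZE from 2′χ(L) and the REGISTERED-currency slack row on the doubly-`ChiGood(μ_L)`-good data at a HIGHER PROFILE `p₁ ≥ 𝔠.p₀`** —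
★r1 g3's `dataOnPrintChiAt_of_laneRecordsChi_slackOnChi` with the higher-profile slot. [cite: King1986, Thm 3.4 (3.9) p.656; Balaban1985UV3, (41) p.266, (47) p.267] -/
theorem dataOnPrintChiAt_of_laneRecordsChi_slackOnChi_higherProfile (L : ℕ) (hLo : Odd L) (hL : 1 < L)
    (h2 : Summit.QuantumFields.YangMills.Theorems.AlphaInputsT3ACv3RecChi L)
    (hIμ :
      ∀ (𝔠 : Summit.QuantumFields.Balaban3D.Proofs.Primitives.AlphaConsts L (Summit.QuantumFields.Balaban3D.Carriers.suGroupModel 2).N)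
        (a₀ a₁ : ℝ), 0 < a₀ → 0 < a₁ → 𝔠.B₃ * a₁ ≤ a₀ →
        ∃ a : ℝ, 0 < a ∧ ∃ p₁ : ℝ, 𝔠.p₀ ≤ p₁ ∧ ∃ γB : ℝ, 0 < γB ∧ ∀ (F : T3Family) (γ : ℝ) (hF : F.L = L) (hγ : 0 < γ), γ ≤ γB →
          ∀ (hγ1 : γ ≤ (min (hF ▸ 𝔠).gamma0 1) ^ 2),
            Summit.QuantumFields.YangMills.Theorems.AlphaInputsT3AC.OfV3ChiAt F (hF ▸ 𝔠) a₀ a₁ →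
            ∃ (p : ∀ K, Summit.QuantumFields.YangMills.Theorems.AlphaInputsT3AC.PkgAtV3Chi F (hF ▸ 𝔠) γ hγ hγ1 K),
              (∀ K, (p K).a₀ = a₀ ∧ (p K).a₁ = a₁) ∧
              ∃ (π : Summit.QuantumFields.YangMills.Theorems.AlphaInputsT3AC.PolymerT3 F) (σ : ℕ) (C : ℝ), 7 ≤ σ ∧ 0 ≤ C ∧
                ∀ ε₀ : ℝ, 0 < ε₀ → ε₀ ≤ a₀ →
                  Summit.QuantumFields.YangMills.Theorems.GlobalSlackOn.GlobalSupRateTSlackOn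
                    (Summit.QuantumFields.YangMills.Theorems.AlphaInputsT3AC.dataOfV3chi p π)
                    (fun K n h V => ChiGood F γ (hF ▸ 𝔠).b₀ (hF ▸ 𝔠).p₀ ε₀ (1 - 2 / ((L : ℝ) * Real.sqrt L)) (n := n) (K := K) h V)
                    (hF ▸ 𝔠).b₀ p₁ a σ C) :
    ∃ (b₁ p₁ : ℝ), ∀ (b₀ p₀ : ℝ), b₁ ≤ b₀ → p₁ ≤ p₀ → 0 < b₀ → 2 < p₀ →
      ∃ ε₁ : ℝ, 0 < ε₁ ∧ ∀ (ε₀ : ℝ), 0 < ε₀ → ε₀ ≤ ε₁ → ∃ m₀ : ℕ, ∀ (m : ℕ), m₀ ≤ m →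
        ∃ γ₁ : ℝ, 0 < γ₁ ∧ ∀ (F : T3Family) (γ : ℝ), F.L = L → 0 < γ → γ ≤ γ₁ →
          ∃ D : AlphaDataT3 F γ,
            (∀ (K n : ℕ) (hnK : n < K) (V : GaugeField (F.P n) 0 (Matrix.specialUnitaryGroup (Fin 2) ℂ)),
              PlaqSmall (θBal F.L γ b₀ p₀ n) V →
                D.Umin K (K - n) (D.triv K (K - n))
                    (fieldShift (F.sitesPerDir_eq (m := F.m) (K := K) (j := K - n) (m' := F.m) (K' := n) (j' := 0) (by omega)) V) ∈
                  regFibrePr F n K hnK.le ε₀ V ∧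
                wilsonAction4 (D.Umin K (K - n) (D.triv K (K - n))
                    (fieldShift (F.sitesPerDir_eq (m := F.m) (K := K) (j := K - n) (m' := F.m) (K' := n) (j' := 0) (by omega)) V)) =
                  minActionRegPr F n K hnK.le ε₀ V) ∧
            TwoSidedRepOn F γ b₀ p₀ (atHeights (printChiSets D b₀ p₀)) ε₀ D.PintH D.EcstH D.RmH ∧
            PintCauchyOn F γ b₀ p₀
              (fun K n h V => ChiGood F γ b₀ p₀ ε₀ (1 - 2 / ((F.L : ℝ) * Real.sqrt F.L)) (n := n) (K := K) h V) m D.PintH := by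
  obtain ⟨b₁, p₁, hrec⟩ := h2
  refine ⟨b₁, p₁, fun b₀ p₀ hb1 hp1 hb hp => ?_⟩
  obtain ⟨𝔠, a₀, a₁, hcb, hcp, ha0, ha1, hw, h𝔠⟩ := hrec b₀ p₀ hb1 hp1
  subst hcb
  subst hcp
  obtain ⟨a, ha, q₁, hq₁, γB, hγB, hBC⟩ := hIμ 𝔠 a₀ a₁ ha0 ha1 hw
  obtain ⟨εs, hεs, hS⟩ := levelCauchyOnOfGlobalSupRateTSlackOn_higherProfile_dec L hLo hL a ha
  refine ⟨min a₀ εs, lt_min ha0 hεs, fun ε₀ h0 h1 => ?_⟩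
  have h1a : ε₀ ≤ a₀ := h1.trans (min_le_left _ _)
  have h1s : ε₀ ≤ εs := h1.trans (min_le_right _ _)
  obtain ⟨m₀, hm₀⟩ := hS ε₀ h0 h1s
  refine ⟨m₀, fun m hm => ?_⟩
  obtain ⟨γT, hγT, -, hT⟩ := Summit.QuantumFields.YangMills.Theorems.LogComparisonAlphaAdapter.exists_gamma_thresholds
    (B₃ := 𝔠.B₃) 𝔠.b₀_pos 𝔠.p₀_pos ha1 𝔠.B₃_pos.le h0
  have hg0 : 0 < (min 𝔠.gamma0 1) ^ 2 := pow_pos (lt_min 𝔠.gamma0_pos one_pos) 2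
  obtain ⟨γs, hγs, hS'⟩ := hm₀ m hm 𝔠.b₀ 𝔠.p₀ hb hp
  refine ⟨min (min γB (min γT ((min 𝔠.gamma0 1) ^ 2))) γs,
    lt_min (lt_min hγB (lt_min hγT hg0)) hγs, fun F γ hF hγ hγ₁ => ?_⟩
  subst hF
  have hγB' : γ ≤ γB := hγ₁.trans ((min_le_left _ _).trans (min_le_left _ _))
  have hγT' : γ ≤ γT := hγ₁.trans ((min_le_left _ _).trans ((min_le_right _ _).trans (min_le_left _ _)))
  have hγ1 : γ ≤ (min 𝔠.gamma0 1) ^ 2 := hγ₁.trans ((min_le_left _ _).trans ((min_le_right _ _).trans (min_le_right _ _)))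
  have hγs' : γ ≤ γs := hγ₁.trans (min_le_right _ _)
  obtain ⟨p, hp', π, σ, C, hσ, hC0, hG⟩ := hBC F γ rfl hγ hγB' hγ1 (h𝔠 F rfl)
  obtain ⟨hT1, hT2, hT3⟩ := hT F.L F.hL.2.le γ hγ hγT'
  refine ⟨Summit.QuantumFields.YangMills.Theorems.AlphaInputsT3AC.dataOfV3chi p π, fun K n hnK V hV => ?_, ?_, ?_⟩
  · exact Summit.QuantumFields.YangMills.Theorems.AlphaInputsT3AC.dataOfV3chi_uminTriv p π K n hnK ε₀
      (by rw [(hp' K).2]; exact hT1 n) (hT2 n) (by rw [(hp' K).1]; exact h1a) V hV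
  · exact Summit.QuantumFields.YangMills.Theorems.AlphaInputsT3AC.twoSidedRepOnPrintChi_dataOfV3chi p π hp' ε₀ h0 h1a hT1 hT2 hT3
  · exact hS' F γ rfl hγ hγs' _ (Summit.QuantumFields.YangMills.Theorems.AlphaInputsT3AC.dataOfV3chi p π) q₁ σ C hq₁ hσ hC0 (hG ε₀ h0 h1a)

/-- **THE DECIDING CRUX FROM 2′χ AND THE REGISTERED-CURRENCY ROW ON χ AT A HIGHER LOG-PROFILE, EVERY ODD BLOCK SIZE**: STUB 1's text, T8's text, 2′χ, and — for every odd `L > 1`,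
every margin `μ ∈ (0,1)`, every record and [7]-constants — a rate `a ∈ (0,1)`, a profile `p₁ ≥ 𝔠.p₀`, a coherent χ-package family and a polymerisation with the slack row
`GlobalSupRateTSlackOn (dataOfV3chi p π) (ChiGood … ε₀ μ) 𝔠.b₀ p₁ a σ C` (= (i*)χ's/3⁗χ's row with `𝔠.p₀ ↦ p₁` in the bound and its window) for every `0 < ε₀ ≤ a₀`, give
`FluctuationComparisonRegPrIntL`.  This is the form a supplier whose displays carry the (28) collar polylog produces directly (`p₁ = 𝔠.p₀ + r₀`-type).
[cite: King1986, Thm 3.4 (3.9) p.656, (3.42) p.660; Balaban1985UV3, (28) p.263, (41) p.266, (47) p.267, (57) p.270, Thm 2 p.272; Balaban1985Variational, Thm 1 (8) p.279; Balaban1987RG1, (0.4) p.253] -/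
theorem regPrIntL_of_recChi_slackOnChi_higherProfile_allL
    (h1 : ∀ L : ℕ, ∃ κ δ₀ : ℝ, κ * Real.sqrt L ≤ 1 ∧ 0 < δ₀ ∧ ∀ F : T3Family, F.L = L → OneStepSmallLift F ℰp κ δ₀)
    (hT8 : ∀ L : ℕ, Odd L → 1 < L → ∃ a₀ a₁ B₃ : ℝ, 0 < a₀ ∧ 0 < a₁ ∧ 0 < B₃ ∧
      Thm1GlobalMinAt L a₀ a₁ B₃ ∧ MinimisersIn8At L a₀ a₁ B₃)
    (h2 : ∀ L : ℕ, Odd L → 1 < L → Summit.QuantumFields.YangMills.Theorems.AlphaInputsT3ACv3RecChi L)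
    (hIP : ∀ (L : ℕ), Odd L → 1 < L → ∀ (μ : ℝ), 0 < μ → μ < 1 →
      ∀ (𝔠 : Summit.QuantumFields.Balaban3D.Proofs.Primitives.AlphaConsts L (Summit.QuantumFields.Balaban3D.Carriers.suGroupModel 2).N)
        (a₀ a₁ : ℝ), 0 < a₀ → 0 < a₁ → 𝔠.B₃ * a₁ ≤ a₀ →
        ∃ a : ℝ, 0 < a ∧ a < 1 ∧ ∃ p₁ : ℝ, 𝔠.p₀ ≤ p₁ ∧ ∃ γB : ℝ, 0 < γB ∧ ∀ (F : T3Family) (γ : ℝ) (hF : F.L = L) (hγ : 0 < γ), γ ≤ γB →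
          ∀ (hγ1 : γ ≤ (min (hF ▸ 𝔠).gamma0 1) ^ 2),
            Summit.QuantumFields.YangMills.Theorems.AlphaInputsT3AC.OfV3ChiAt F (hF ▸ 𝔠) a₀ a₁ →
            ∃ (p : ∀ K, Summit.QuantumFields.YangMills.Theorems.AlphaInputsT3AC.PkgAtV3Chi F (hF ▸ 𝔠) γ hγ hγ1 K),
              (∀ K, (p K).a₀ = a₀ ∧ (p K).a₁ = a₁) ∧
              ∃ (π : Summit.QuantumFields.YangMills.Theorems.AlphaInputsT3AC.PolymerT3 F) (σ : ℕ) (C : ℝ), 7 ≤ σ ∧ 0 ≤ C ∧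
                ∀ ε₀ : ℝ, 0 < ε₀ → ε₀ ≤ a₀ →
                  Summit.QuantumFields.YangMills.Theorems.GlobalSlackOn.GlobalSupRateTSlackOn
                    (Summit.QuantumFields.YangMills.Theorems.AlphaInputsT3AC.dataOfV3chi p π)
                    (fun K n h V => ChiGood F γ (hF ▸ 𝔠).b₀ (hF ▸ 𝔠).p₀ ε₀ μ (n := n) (K := K) h V)
                    (hF ▸ 𝔠).b₀ p₁ a σ C) :
    FluctuationComparisonRegPrIntL :=
  regPrIntL_of_dataOnPrintChi hT8
    (fun L hLo hL => by
      have hμ := muL_pos_lt_one hL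
      exact dataOnPrintChiAt_of_laneRecordsChi_slackOnChi_higherProfile L hLo hL (h2 L hLo hL) fun 𝔠 a₀ a₁ ha0 ha1 hw => by
        obtain ⟨a, ha, -, p₁, hp₁, γB, hγB, hall⟩ := hIP L hLo hL _ hμ.1 hμ.2 𝔠 a₀ a₁ ha0 ha1 hw
        exact ⟨a, ha, p₁, hp₁, γB, hγB, hall⟩)
    (Summit.QuantumFields.YangMills.Theorems.OneStepSubmersion.posOnSmall_of_oneStepSmallLift h1)

end Summit.QuantumFields.YangMills.Theorems.InteriorExcision

end
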